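import Literature.MeasureTheory.Group.OrbitalDescentCentralizer     -- ★ p08 (g13): `orbitalIntegral_eq_orbitalIntegral_descended`
import Literature.MeasureTheory.Group.OrbitalDescentFunction        -- ★ p08 (g13): `hasCompactSupport_integral_conj`
import Literature.MeasureTheory.Group.ConjugationCutoff             -- ★ p08 (g13): `exists_continuous_hasCompactSupport_integral_comp_mul_eq_one`
import Mathlib.MeasureTheory.Integral.Bochner.Set
import HarnessLib

/-!
# Harish-Chandra's descent of orbital integrals, ARCHIMEDEAN dress: the descended function is continuous, and ONE descended function serves a whole
# neighbourhood of a semi-regular point (Rogawski 1990 §4.12 Lemma 4.12.1, §8.2 p. 114; Harish-Chandra–van Dijk 1970 Part I §3 Lemmas 21–23)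

Topic `MeasureTheory/Group`; namespace `Literature.MeasureTheory.Group` (continues ★ `OrbitalDescentFunction` (M2a), ★ `OrbitalDescentCentralizer` (the identity) of F0P3a-p08 (g13)).
THEOREMS ONLY (no definition — the descended function is written inline, as in ★ M2a —, no instance, no notation, no axiom, no named fact, no `sorry`).  GENERIC topology ∕
measure theory on a locally compact group.  Cell `pub/hodgecm-mathlib`, crux H413 (`stmt-HodgeConjecture-24833`), F0∕P3c line LH3 (closer stub `stub_N9`, organ J), brick
**(J-DESC) FILE D2** (seat F0P3a-p08 (g22)); the group-specific input (the uniform «compact modulo `M`» set `C`) is ★∕filed `UnitaryFormGroupSemiregularProper[Diagonal]` (D1∕D1b).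

THE MATHEMATICS.  `ψ_M^β(m) := ∫_G β(x) • ψ(x m x⁻¹) dν(x)` for a cut-off `β ∈ C_c(G)` and a test function `ψ`.
* §1 For `ψ` CONTINUOUS (the archimedean case; ★ M2a treats the locally constant p-adic case) and `β ∈ C_c(G)` continuous, `m ↦ ψ_M^β(m)` is CONTINUOUS on `G` (hence on
  every subgroup `M`): the integrand is jointly continuous and supported in the fixed compact `tsupport β` (Mathlib `continuous_parametric_integral_of_continuous`);
  with ★ `hasCompactSupport_integral_conj` this puts `ψ_M^β ∈ C_c(M)` for `M` closed (`continuous_integral_conj`, `continuous_integral_conj_subtype`).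
* §2 **UNIFORM DESCENT** (`exists_descended_forall_orbitalIntegral_eq`): if ONE compact `C ⊆ G` satisfies «`y·t·y⁻¹ ∈ tsupport ψ ⇒ y ∈ C·M`» for ALL `t = c(x)`, `x ∈ K`
  (Rogawski's Lemma 4.12.1 ∕ Harish-Chandra's compactness lemma — for `U(J)(ℂ)` this is ★∕filed `exists_isCompact_mul_diagonal_of_ne`, valid ACROSS the walls of the
  eigenvalues other than the simple one), then ONE cut-off `β` (★ `exists_continuous_hasCompactSupport_integral_comp_mul_eq_one`) and hence ONE function
  `ψ_M := ψ_M^β ∈ C_c(M)` satisfy `Φ^G(c(x), ψ; ν∕νT) = Φ^M(c(x), ψ_M; νM∕νT′)` for EVERY `x ∈ K` (★ `orbitalIntegral_eq_orbitalIntegral_descended` pointwise) — so the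
  behaviour of `x ↦ Φ^G(c(x), ψ)` across a wall inside `c(K)` (continuity, one-sided limits, jumps) IS that of the `M`-orbital integral of the single function `ψ_M`
  (for `G′_w = U(2,1)`, `M = Z(s) = U(1,1) × U(1)`: the ★ (K0±)-U11 jump of `ArchRankOneJumpZero`).
HONEST LABEL: HC_CM is proved only modulo the 7 printed citations (2 remaining named inputs: hLiu418 = `stmt-HodgeConjecture-24832`, h413 = `stmt-HodgeConjecture-24833`) until rung 0
closes; generic measure theory, count-neutral.

## References
* [Rogawski1990] J. D. Rogawski, *Automorphic Representations of Unitary Groups in Three Variables*, Ann. of Math. Stud. 123 (1990), §4.12 Lemma 4.12.1 p. 66 (the compactness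
  lemma and `φ(m) = ∫ α(g) ϕ(g⁻¹ m δ₀ ε(g)) dg`: «`φ` is smooth since `α` has compact support … `φ` has compact support»), §8.2 p. 114 (`f₁(δ) = ∫_G α(g) f(g⁻¹δγε(g)) dg`).
* [HarishChandra1970] Harish-Chandra (notes by G. van Dijk), *Harmonic Analysis on Reductive p-adic Groups*, LNM 162 (1970), Part I §3 Lemmas 21–23.
* [Folland1995] G. B. Folland, *A Course in Abstract Harmonic Analysis* (1995), §2.6 Thm. 2.49.
-/

set_option autoImplicit false

noncomputable section

open MeasureTheory Topology Set Filter Function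
open scoped Pointwise

namespace Literature.MeasureTheory.Group

/-! ## §1 The archimedean descended function is continuous -/

section Continuous

variable {G : Type*} [Group G] [TopologicalSpace G] [IsTopologicalGroup G] [LocallyCompactSpace G] [SecondCountableTopology G]
  [MeasurableSpace G] [BorelSpace G] (ν : Measure G) [IsFiniteMeasureOnCompacts ν]
  {E : Type*} [NormedAddCommGroup E] [NormedSpace ℝ E]

/-- **The descended function is CONTINUOUS** (archimedean dress of ★ `isLocallyConstant_integral_conj`): for `β ∈ C_c(G)` and `ψ` continuous, `m ↦ ∫_G β(x) • ψ(x m x⁻¹) dν(x)` is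
continuous on `G` — the integrand is jointly continuous in `(m, x)` and vanishes for `x ∉ tsupport β`, a compact set independent of `m`.
[cite: Rogawski1990, §4.12 Lemma 4.12.1 p. 66] [cite: HarishChandra1970, Part I §3 Lemma 21] -/
theorem continuous_integral_conj {β : G → ℝ} (hβc : Continuous β) (hβs : HasCompactSupport β) {ψ : G → E} (hψc : Continuous ψ) :
    Continuous fun m : G => ∫ x, β x • ψ (x * m * x⁻¹) ∂ν := by
  have hzero : ∀ m x, x ∉ tsupport β → β x • ψ (x * m * x⁻¹) = 0 := fun m x hx => by
    rw [image_eq_zero_of_notMem_tsupport hx, zero_smul]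
  have heq : (fun m : G => ∫ x, β x • ψ (x * m * x⁻¹) ∂ν) = fun m : G => ∫ x in tsupport β, β x • ψ (x * m * x⁻¹) ∂ν := by
    funext m
    exact (setIntegral_eq_integral_of_forall_compl_eq_zero fun x hx => hzero m x hx).symm
  rw [heq]
  have hF : Continuous (Function.uncurry fun (m : G) (x : G) => β x • ψ (x * m * x⁻¹)) :=
    (hβc.comp continuous_snd).smul (hψc.comp ((continuous_snd.mul continuous_fst).mul continuous_snd.inv))
  exact continuous_parametric_integral_of_continuous hF hβs.isCompact

/-- The descended function restricted to a subgroup `M` is continuous. [cite: Rogawski1990, §4.12 Lemma 4.12.1 p. 66] [cite: HarishChandra1970, Part I §3 Lemma 21] -/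
theorem continuous_integral_conj_subtype (M : Subgroup G) {β : G → ℝ} (hβc : Continuous β) (hβs : HasCompactSupport β) {ψ : G → E} (hψc : Continuous ψ) :
    Continuous fun m : M => ∫ x, β x • ψ (x * (m : G) * x⁻¹) ∂ν :=
  (continuous_integral_conj ν hβc hβs hψc).comp continuous_subtype_val

end Continuous

/-! ## §2 Uniform descent: one descended function for a whole compact family of base points -/

section Uniform

variable {G : Type*} [Group G] [TopologicalSpace G] [IsTopologicalGroup G] [LocallyCompactSpace G] [SecondCountableTopology G]
  [T2Space G] [MeasurableSpace G] [BorelSpace G]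

/-- **UNIFORM DESCENT NEAR A SEMI-REGULAR POINT.**  `ν` a Haar measure on `G`, `M ≤ G` closed with a right- and inversion-invariant Haar measure `νM`, `c : X → M` a family of base
points (e.g. a torus chart through a singular `s` with `Z(s) = M`), `ψ ∈ C_c(G)`, and ONE compact `C ⊆ G` with `y·c(x)·y⁻¹ ∈ tsupport ψ ⇒ y ∈ C·M` for all `x ∈ K` (the compactness
lemma: Rogawski's Lemma 4.12.1; for `U(J)(ℂ)` the filed `UnitaryGroup.exists_isCompact_mul_diagonal_of_ne`).  Then there is ONE `ψ_M ∈ C_c(M)` (continuous, compactly supported —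
namely `ψ_M(m) = ∫_G β(x) • ψ(x m x⁻¹) dν` for a cut-off `β` of unit `M`-mass on `C·M`) such that for EVERY `x ∈ K`, with `t = c(x)`, `T = Z_G(t)`, `T′ = Z_M(t)` and matched Haar
measures `νT = incl_* νT′`:  `Φ^G(t, ψ; ν∕νT) = Φ^M(t, ψ_M; νM∕νT′)` (★ `orbitalIntegral_eq_orbitalIntegral_descended`, whose remaining per-point binders are passed through
verbatim).  Consequently every statement about `x ↦ Φ^G(c(x), ψ)` on `K` — continuity, one-sided limits, jumps across a wall — is the corresponding statement for the
`M`-orbital integrals of the single test function `ψ_M`. [cite: Rogawski1990, §4.12 Lemma 4.12.1 p. 66; §8.2 p. 114] [cite: HarishChandra1970, Part I §3 Lemmas 22–23] -/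
theorem exists_descended_forall_orbitalIntegral_eq
    (ν : Measure G) [ν.IsHaarMeasure] [ν.IsMulRightInvariant]
    (M : Subgroup G) (hM : IsClosed (M : Set G))
    (νM : Measure M) [νM.IsHaarMeasure] [νM.IsMulRightInvariant] [νM.IsInvInvariant]
    {X : Type*} (c : X → M) {K : Set X}
    {ψ : G → ℂ} (hψc : Continuous ψ) (hψs : HasCompactSupport ψ)
    {C : Set G} (hC : IsCompact C) (hCM : ∀ x ∈ K, ∀ y : G, y * ((c x : M) : G) * y⁻¹ ∈ tsupport ψ → y ∈ C * (M : Set G)) :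
    ∃ ψM : M → ℂ, Continuous ψM ∧ HasCompactSupport ψM ∧
      ∀ x ∈ K,
        ∀ [hT : IsClosed ((Subgroup.centralizer ({((c x : M) : G)} : Set G) : Subgroup G) : Set G)]
          [hT' : IsClosed ((Subgroup.centralizer ({c x} : Set M) : Subgroup M) : Set M)]
          [MeasurableSpace (G ⧸ Subgroup.centralizer ({((c x : M) : G)} : Set G))] [BorelSpace (G ⧸ Subgroup.centralizer ({((c x : M) : G)} : Set G))]
          [MeasurableSpace (M ⧸ Subgroup.centralizer ({c x} : Set M))] [BorelSpace (M ⧸ Subgroup.centralizer ({c x} : Set M))]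
          (νT : Measure (Subgroup.centralizer ({((c x : M) : G)} : Set G))) [νT.IsHaarMeasure] [νT.IsMulRightInvariant] [νT.IsInvInvariant]
          (νT' : Measure (Subgroup.centralizer ({c x} : Set M))) [νT'.IsHaarMeasure] [νT'.IsInvInvariant],
          νT = Measure.map (fun s : Subgroup.centralizer ({c x} : Set M) =>
            (⟨((s : M) : G), Subgroup.mem_centralizer_singleton_iff.2 (by
              have h := Subgroup.mem_centralizer_singleton_iff.1 s.2
              exact_mod_cast congrArg ((↑) : M → G) h)⟩ : Subgroup.centralizer ({((c x : M) : G)} : Set G))) νT' →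
          IsClosed {g : G | ∃ y : G, y * ((c x : M) : G) * y⁻¹ = g} →
            Literature.NumberTheory.Automorphic.orbitalIntegral ((c x : M) : G) ψ
                (quotientMeasure (Subgroup.centralizer ({((c x : M) : G)} : Set G)) νT hT ν) =
              Literature.NumberTheory.Automorphic.orbitalIntegral (c x) ψM
                (quotientMeasure (Subgroup.centralizer ({c x} : Set M)) νT' hT' νM) := by
  -- ONE cut-off `β` of unit `M`-mass on `C · M`
  obtain ⟨β, hβc, hβs, hβ0, hβ1⟩ := exists_continuous_hasCompactSupport_integral_comp_mul_eq_one M hM νM hC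
  refine ⟨fun m : M => ∫ x, β x • ψ (x * (m : G) * x⁻¹) ∂ν, continuous_integral_conj_subtype ν M hβc hβs hψc,
    hasCompactSupport_integral_conj ν M hM hβs hψs, ?_⟩
  intro x hx hT hT' _ _ _ _ νT _ _ _ νT' _ _ hνT hO
  exact orbitalIntegral_eq_orbitalIntegral_descended ν M hM νM (c x) νT νT' hνT hO hβc hβs hβ0 hβ1 hψc hψs (hCM x hx)

end Uniform

end Literature.MeasureTheory.Group
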